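import Literature.Analysis.UnboundedOperators.CoreFormLevels
import Mathlib.MeasureTheory.Function.L2Space
import Mathlib.MeasureTheory.Function.LpOrder
import HarnessLib

/-!
# Simplicity of the lowest min–max level of a semibounded form on `L²`, read on its core
# (the variational Perron–Frobenius argument: Beurling–Deny contraction + positivity of nonneg ground states)

Companion of `Literature.Analysis.UnboundedOperators.CoreFormLevels` (`exists_core_form_eigenseq`: the
min–max levels `μ₀ ≤ μ₁ ≤ ⋯ → ∞` of a symmetric operator `S ≥ 0` with compact resolvent, in the language of
a CORE `V` with inner product `(𝔥 + 1)[f, g]`, `ι : V → H` the inclusion, `⟪f, g⟫_V = ⟪S f, ι g⟫ + ⟪ι f, ι g⟫`).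
Here `H = L²(X, μ)` (real scalars) and we prove, still ENTIRELY IN CORE LANGUAGE, the classical criterion
for the ground level to be SIMPLE, `μ₀ < μ₁`:

★ `sInf_coreLevelSet_zero_lt_one` — if, in addition to the data of `exists_core_form_eigenseq`,
* **(contraction)** for every core element `f` and `ε > 0` there is a core element `f'` with
  `‖ι f' − |ι f|‖_{L²} ≤ ε` and `‖f'‖_V ≤ ‖f‖_V + ε` (the absolute value does not increase the form and
  `|f|` is approximable inside the core — Beurling–Deny's first criterion read on a core: for `𝔥 = ∫ ½|∇f|² +
  V f²` take `f' = (f² + δ²)^{1/2} − δ`), and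
* **(positivity)** every NONNEGATIVE, nonzero `w ∈ L²` in the closure of `ι(V)` that solves the weak
  eigen-equation `⟪w, S g⟫ = c ⟪w, ι g⟫` for all core `g` (some `c`) is STRICTLY positive in the sense
  `⟪w, v⟫ > 0` for every `v ≥ 0`, `v ≠ 0` (for Schrödinger operators: elliptic regularity + the strong
  minimum principle / Harnack, or positivity improvement of the semigroup),
then `inf {s | ∃ W ⊆ V, dim W = 1, 𝔥 ≤ s‖ι·‖² on W} < inf {s | ∃ W ⊆ V, dim W = 2, 𝔥 ≤ s‖ι·‖² on W}`
(`𝔥[f] = ‖f‖_V² − ‖ι f‖²`), i.e. `μ₀ < μ₁`: the ground state is unique.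

This is Reed–Simon IV Thm XIII.48 / Glimm–Jaffe Cor 3.3.4 («the ground state … is unique») in the
VARIATIONAL form of Courant–Hilbert (Vol. I, Ch. VI §6: «the first eigenfunction does not change sign; the
smallest eigenvalue is simple») and Lieb–Loss (*Analysis*, Thm 11.8 «uniqueness of minimizers»: a minimizer
`ψ` has `|ψ|` a minimizer, `|ψ| > 0`, hence `ψ⁺` or `ψ⁻` vanishes and two orthogonal minimizers are
impossible).  PROOF (kernel-checked below).  Complete the core to `Q` with the injective compact embedding
`J : Q → H` (Kato VI Thm 1.27, Rellich; the tree's `ClosableFormCriteria`), take the form eigenvectors `e_k`,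
levels `μ_k` of `CompactEmbeddingFormLevels.exists_form_eigenseq`; `q̃(x) = ‖x‖_Q² − (μ₀+1)‖Jx‖² ≥ 0` on `Q`
(min–max at level `0`), its null set `G` (the ground space) is a linear subspace whose elements satisfy the
weak eigen-equation (first variation) and contains `e₀`, and `e₁` too if `μ₁ = μ₀`.  CONTRACTION gives, for
`x ∈ G` approximated by core elements `f_n`, core elements `f'_n` with `ι f'_n → |Jx|` and
`limsup ‖f'_n‖ ≤ ‖x‖`, so `q̃(f'_n) → 0`; the parallelogram law for `q̃ ≥ 0` makes `(f'_n)` Cauchy in `Q`,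
its limit `x'` lies in `G` with `J x' = |J x|`.  Hence `(Jx)⁺ = J((x'+x)/2)` and `(Jx)⁻ = J((x'−x)/2)` are
images of ground states, nonnegative; by POSITIVITY they cannot both be nonzero (`⟪(Jx)⁺, (Jx)⁻⟫ = 0` in
`L²`), so every ground state has a sign and `|Jx|` is strictly positive; two `L²`-orthogonal ground states
`J e₀ ⊥ J e₁` are then impossible.  Hence `μ₀ < μ₁`.

No definitions, no named facts, no instances, no notation.

## References
* [ReedSimonIV1978] M. Reed, B. Simon, *Methods of Modern Mathematical Physics IV*, §XIII.12 Thm XIII.48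
  (uniqueness and positivity of the ground state of `−Δ + V`), Thm XIII.2, Thm XIII.64.
* [GlimmJaffeQP1987] J. Glimm, A. Jaffe, *Quantum Physics*, 2nd ed., §3.3 Thm 3.3.2–3.3.3, Cor 3.3.4.
* [LiebLoss2001] E. H. Lieb, M. Loss, *Analysis*, 2nd ed., AMS GSM 14, Thm 7.8 (`‖∇|f|‖₂ ≤ ‖∇f‖₂`),
  Thm 9.10 (positivity), Thm 11.8 (uniqueness of minimizers / positivity of the ground state).
* [Kato1966] T. Kato, *Perturbation Theory for Linear Operators*, VI Thm 1.27, Thm 2.1/2.6.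
-/

noncomputable section

open UniformSpace Filter _root_.Topology _root_.MeasureTheory
open scoped InnerProductSpace

namespace Literature.Analysis.UnboundedOperators

open Literature.Analysis.OperatorTheory

/-! ### 1. An `L²`-lattice fact and two pieces of quadratic-form algebra -/

section L2Lattice

variable {X : Type*} [MeasurableSpace X] {μX : Measure X}

/-- In `L²`, the positive and negative parts of a function are orthogonal: `⟪f⁺, f⁻⟫ = ∫ f⁺ f⁻ = 0`
(`max(f,0) · max(−f,0) = 0` pointwise). [cite: LiebLoss2001, Thm. 11.8 (proof)] -/
theorem inner_posPart_negPart_eq_zero (f : Lp ℝ 2 μX) : ⟪f⁺, f⁻⟫_ℝ = 0 := by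
  rw [L2.inner_def]
  have h1 : ⇑(f⁺) =ᵐ[μX] fun x => max (f x) 0 := by
    rw [posPart_def]
    filter_upwards [Lp.coeFn_sup f 0, Lp.coeFn_zero ℝ 2 μX] with x hx h0
    rw [hx, Pi.sup_apply, h0, Pi.zero_apply]
  have h2 : ⇑(f⁻) =ᵐ[μX] fun x => max (-f x) 0 := by
    rw [negPart_def]
    filter_upwards [Lp.coeFn_sup (-f) 0, Lp.coeFn_zero ℝ 2 μX, Lp.coeFn_neg f] with x hx h0 hn
    rw [hx, Pi.sup_apply, h0, Pi.zero_apply, hn, Pi.neg_apply]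
  have h3 : (fun x => ⟪(⇑(f⁺)) x, (⇑(f⁻)) x⟫_ℝ) =ᵐ[μX] fun _ => (0 : ℝ) := by
    filter_upwards [h1, h2] with x hx1 hx2
    rw [hx1, hx2]
    rcases le_total 0 (f x) with h | h <;> simp [h]
  rw [integral_congr_ae h3, integral_zero]

end L2Lattice

section QuadForm

variable {Q : Type*} [NormedAddCommGroup Q] [InnerProductSpace ℝ Q]
variable {H : Type*} [NormedAddCommGroup H] [InnerProductSpace ℝ H]

/-- Expansion of the quadratic form `q̃(x) = ‖x‖² − c‖Jx‖²` on a two-term combination (polarisation).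
[cite: Kato1966, VI §1.1 (1.2) (polarisation of a sesquilinear form)] -/
private theorem qf_expand (J : Q →L[ℝ] H) (c a b : ℝ) (x y : Q) :
    ‖a • x + b • y‖ ^ 2 - c * ‖J (a • x + b • y)‖ ^ 2 =
      a ^ 2 * (‖x‖ ^ 2 - c * ‖J x‖ ^ 2) + b ^ 2 * (‖y‖ ^ 2 - c * ‖J y‖ ^ 2) +
        2 * a * b * (⟪x, y⟫_ℝ - c * ⟪J x, J y⟫_ℝ) := by
  rw [map_add, map_smul, map_smul, norm_add_sq_real, norm_add_sq_real, norm_smul, norm_smul, norm_smul,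
    norm_smul, real_inner_smul_left, real_inner_smul_right, real_inner_smul_left, real_inner_smul_right]
  simp only [Real.norm_eq_abs, mul_pow, sq_abs]
  ring

/-- If `2tB + t²A ≥ 0` for all real `t` (with `A ≥ 0`), then `B = 0` (the first-variation step).
[cite: LiebLoss2001, Thm. 11.8 (proof)] -/
private theorem linear_coeff_eq_zero {A B : ℝ} (hA : 0 ≤ A) (h : ∀ t : ℝ, 0 ≤ 2 * t * B + t ^ 2 * A) :
    B = 0 := by
  have hA1 : 0 < A + 1 := by linarith
  have hD : 0 < (A + 1) ^ 2 := by positivity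
  have ht := h (-B / (A + 1))
  have hcalc : 2 * (-B / (A + 1)) * B + (-B / (A + 1)) ^ 2 * A = -(B ^ 2 * (A + 2)) / (A + 1) ^ 2 := by
    field_simp
    ring
  rw [hcalc] at ht
  have ht2 : 0 ≤ -(B ^ 2 * (A + 2)) := by
    have := mul_nonneg ht hD.le
    rwa [div_mul_cancel₀ _ hD.ne'] at this
  have hB2 : B ^ 2 = 0 := by nlinarith [sq_nonneg B]
  exact pow_eq_zero_iff two_ne_zero |>.1 hB2

/-- Parallelogram consequence for a nonnegative quadratic form `q̃ = ‖·‖² − c‖J·‖²`: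
`‖a − b‖² ≤ 2q̃(a) + 2q̃(b) + c‖Ja − Jb‖²`. [cite: Kato1966, VI §1.1 (1.2) (polarisation of a sesquilinear form)] -/
private theorem qf_norm_sub_sq_le (J : Q →L[ℝ] H) {c : ℝ} (hq : ∀ z : Q, 0 ≤ ‖z‖ ^ 2 - c * ‖J z‖ ^ 2)
    (a b : Q) :
    ‖a - b‖ ^ 2 ≤ 2 * (‖a‖ ^ 2 - c * ‖J a‖ ^ 2) + 2 * (‖b‖ ^ 2 - c * ‖J b‖ ^ 2) + c * ‖J a - J b‖ ^ 2 := by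
  have h1 := qf_expand J c 1 1 a b
  have h2 := qf_expand J c 1 (-1) a b
  have hs := hq ((1 : ℝ) • a + (1 : ℝ) • b)
  rw [h1] at hs
  have hd : (1 : ℝ) • a + (-1 : ℝ) • b = a - b := by rw [one_smul, neg_one_smul, sub_eq_add_neg]
  rw [hd, map_sub] at h2
  nlinarith [h2, hs]

end QuadForm

/-! ### 2. The contraction step: a null vector `x` of `q̃` has a null vector `x'` with `J x' = |J x|` -/

section Contraction

variable {X : Type*} [MeasurableSpace X] {μX : Measure X}
variable {V : Type*} [NormedAddCommGroup V] [InnerProductSpace ℝ V]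

/-- **CONTRACTION, lifted to the completed form domain.**  If `q̃ = ‖·‖_Q² − c‖J·‖² ≥ 0` on `Q = V̂`
(`J` extending `ι`), and every core element `f` has core elements `f'` with `ι f'` close to `|ι f|` and
`‖f'‖ ≤ ‖f‖ + ε`, then for every null vector `x` of `q̃` there is a null vector `x'` with `J x' = |J x|`
(approximate `x` by core elements, contract them, and use the parallelogram law for `q̃ ≥ 0` to see that
the contracted approximants are Cauchy). [cite: LiebLoss2001, Thm. 7.8 / Thm. 11.8 (proof: `|ψ|` is again a minimizer)] -/
private theorem exists_null_abs (ι : V →L[ℝ] Lp ℝ 2 μX) (J : Completion V →L[ℝ] Lp ℝ 2 μX)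
    (hJcoe : ∀ f : V, J (f : Completion V) = ι f) {c : ℝ} (hc0 : 0 < c)
    (hq : ∀ z : Completion V, 0 ≤ ‖z‖ ^ 2 - c * ‖J z‖ ^ 2)
    (habs : ∀ (f : V) (ε : ℝ), 0 < ε → ∃ f' : V, ‖ι f' - |ι f|‖ ≤ ε ∧ ‖f'‖ ≤ ‖f‖ + ε)
    (x : Completion V) (hx : ‖x‖ ^ 2 - c * ‖J x‖ ^ 2 = 0) :
    ∃ x' : Completion V, ‖x'‖ ^ 2 - c * ‖J x'‖ ^ 2 = 0 ∧ J x' = |J x| := by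
  -- `q̃` on the core
  have hqV : ∀ f : V, 0 ≤ ‖f‖ ^ 2 - c * ‖ι f‖ ^ 2 := fun f => by
    have h := hq (f : Completion V)
    rwa [Completion.norm_coe, hJcoe] at h
  -- core elements `f n → x` in `Q`
  have hxcl : x ∈ closure (Set.range ((↑) : V → Completion V)) := by
    rw [Completion.denseRange_coe.closure_range]; exact Set.mem_univ x
  obtain ⟨u, hu_mem, hu_lim⟩ := mem_closure_iff_seq_limit.1 hxcl
  choose f hf using hu_mem
  have hf_lim : Tendsto (fun n => (f n : Completion V)) atTop (𝓝 x) := by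
    have : (fun n => (f n : Completion V)) = u := funext hf
    rw [this]; exact hu_lim
  -- the contracted approximants `f' n`
  have hεpos : ∀ n : ℕ, (0 : ℝ) < 1 / ((n : ℝ) + 1) := fun n => by positivity
  choose f' hf'1 hf'2 using fun n : ℕ => habs (f n) (1 / ((n : ℝ) + 1)) (hεpos n)
  have hε_lim : Tendsto (fun n : ℕ => 1 / ((n : ℝ) + 1)) atTop (𝓝 0) :=
    tendsto_one_div_add_atTop_nhds_zero_nat
  -- (a) `ι f'_n → |J x|`
  have hJf_lim : Tendsto (fun n => ι (f n)) atTop (𝓝 (J x)) := by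
    have h := (J.continuous.tendsto x).comp hf_lim
    refine h.congr fun n => ?_
    simp only [Function.comp_apply, hJcoe]
  have habsJf_lim : Tendsto (fun n => |ι (f n)|) atTop (𝓝 |J x|) := by
    rw [tendsto_iff_norm_sub_tendsto_zero] at hJf_lim ⊢
    exact squeeze_zero (fun n => norm_nonneg _) (fun n => norm_abs_sub_abs _ _) hJf_lim
  have hιf'_lim : Tendsto (fun n => ι (f' n)) atTop (𝓝 |J x|) := by
    rw [tendsto_iff_norm_sub_tendsto_zero] at habsJf_lim ⊢
    have hbound : ∀ n, ‖ι (f' n) - |J x|‖ ≤ 1 / ((n : ℝ) + 1) + ‖|ι (f n)| - |J x|‖ := fun n =>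
      calc ‖ι (f' n) - |J x|‖ = ‖(ι (f' n) - |ι (f n)|) + (|ι (f n)| - |J x|)‖ := by
            congr 1; abel
        _ ≤ ‖ι (f' n) - |ι (f n)|‖ + ‖|ι (f n)| - |J x|‖ := norm_add_le _ _
        _ ≤ 1 / ((n : ℝ) + 1) + ‖|ι (f n)| - |J x|‖ := by gcongr; exact hf'1 n
    refine squeeze_zero (fun n => norm_nonneg _) hbound ?_
    simpa using hε_lim.add habsJf_lim
  -- (b) `q̃(f'_n) → 0`
  have hnormf_lim : Tendsto (fun n => ‖f n‖) atTop (𝓝 ‖x‖) := by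
    have h := (continuous_norm.tendsto x).comp hf_lim
    refine h.congr fun n => ?_
    simp only [Function.comp_apply, Completion.norm_coe]
  have hq'_le : ∀ n, ‖f' n‖ ^ 2 - c * ‖ι (f' n)‖ ^ 2 ≤
      (‖f n‖ + 1 / ((n : ℝ) + 1)) ^ 2 - c * ‖ι (f' n)‖ ^ 2 := fun n => by
    have h1 : ‖f' n‖ ^ 2 ≤ (‖f n‖ + 1 / ((n : ℝ) + 1)) ^ 2 :=
      pow_le_pow_left₀ (norm_nonneg _) (hf'2 n) 2
    linarith
  have hupper_lim : Tendsto (fun n : ℕ => (‖f n‖ + 1 / ((n : ℝ) + 1)) ^ 2 - c * ‖ι (f' n)‖ ^ 2)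
      atTop (𝓝 0) := by
    have h1 : Tendsto (fun n : ℕ => (‖f n‖ + 1 / ((n : ℝ) + 1)) ^ 2) atTop (𝓝 (‖x‖ ^ 2)) := by
      have := (hnormf_lim.add hε_lim).pow 2
      simpa using this
    have h2 : Tendsto (fun n => c * ‖ι (f' n)‖ ^ 2) atTop (𝓝 (c * ‖J x‖ ^ 2)) := by
      have := ((continuous_norm.tendsto _).comp hιf'_lim).pow 2
      rw [Function.comp_def, norm_abs_eq_norm] at this
      exact this.const_mul c
    have h3 := h1.sub h2
    rwa [hx] at h3
  have hq'_lim : Tendsto (fun n => ‖f' n‖ ^ 2 - c * ‖ι (f' n)‖ ^ 2) atTop (𝓝 0) :=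
    tendsto_of_tendsto_of_tendsto_of_le_of_le tendsto_const_nhds hupper_lim (fun n => hqV (f' n)) hq'_le
  -- (c) `(f'_n)` is Cauchy in `V` (parallelogram law for `q̃ ≥ 0` on the core)
  have hpar : ∀ n m, ‖f' n - f' m‖ ^ 2 ≤
      2 * (‖f' n‖ ^ 2 - c * ‖ι (f' n)‖ ^ 2) + 2 * (‖f' m‖ ^ 2 - c * ‖ι (f' m)‖ ^ 2) +
        c * ‖ι (f' n) - ι (f' m)‖ ^ 2 := fun n m => qf_norm_sub_sq_le ι hqV (f' n) (f' m)
  have hcauchyV : CauchySeq f' := by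
    rw [Metric.cauchySeq_iff]
    intro ε hε
    have hε2 : 0 < ε ^ 2 / 5 := by positivity
    have hιC : CauchySeq fun n => ι (f' n) := hιf'_lim.cauchySeq
    rw [Metric.cauchySeq_iff] at hιC
    obtain ⟨N₁, hN₁⟩ := hιC (Real.sqrt (ε ^ 2 / 5 / c)) (Real.sqrt_pos.2 (div_pos hε2 hc0))
    obtain ⟨N₂, hN₂⟩ := (Metric.tendsto_atTop.1 hq'_lim) (ε ^ 2 / 5) hε2
    refine ⟨max N₁ N₂, fun m hm n hn => ?_⟩
    have hm1 : m ≥ N₁ := le_trans (le_max_left _ _) hm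
    have hn1 : n ≥ N₁ := le_trans (le_max_left _ _) hn
    have hm2 : m ≥ N₂ := le_trans (le_max_right _ _) hm
    have hn2 : n ≥ N₂ := le_trans (le_max_right _ _) hn
    have h1 : ‖ι (f' m) - ι (f' n)‖ ^ 2 < ε ^ 2 / 5 / c := by
      have h := hN₁ m hm1 n hn1
      rw [dist_eq_norm] at h
      have h' := pow_lt_pow_left₀ h (norm_nonneg _) two_ne_zero
      rwa [Real.sq_sqrt (div_pos hε2 hc0).le] at h'
    have h1' : c * ‖ι (f' m) - ι (f' n)‖ ^ 2 < ε ^ 2 / 5 := by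
      have := mul_lt_mul_of_pos_left h1 hc0
      rwa [mul_div_cancel₀ _ hc0.ne'] at this
    have h2 : ‖f' m‖ ^ 2 - c * ‖ι (f' m)‖ ^ 2 < ε ^ 2 / 5 := by
      have h := hN₂ m hm2
      rw [dist_eq_norm, sub_zero, Real.norm_eq_abs] at h
      exact lt_of_abs_lt h
    have h3 : ‖f' n‖ ^ 2 - c * ‖ι (f' n)‖ ^ 2 < ε ^ 2 / 5 := by
      have h := hN₂ n hn2
      rw [dist_eq_norm, sub_zero, Real.norm_eq_abs] at h
      exact lt_of_abs_lt h
    have h4 : ‖f' m - f' n‖ ^ 2 < ε ^ 2 := by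
      have := hpar m n
      linarith
    rw [dist_eq_norm]
    exact lt_of_pow_lt_pow_left₀ 2 hε.le h4
  have hcauchy : CauchySeq fun n => (f' n : Completion V) :=
    (Completion.uniformContinuous_coe V).comp_cauchySeq hcauchyV
  -- (d) the limit `x'`
  obtain ⟨x', hx'⟩ := cauchySeq_tendsto_of_complete hcauchy
  have hcoe_seq : (fun n => J (f' n : Completion V)) = fun n => ι (f' n) := funext fun n => hJcoe (f' n)
  have hJx' : J x' = |J x| := by
    have h1 : Tendsto (fun n => J (f' n : Completion V)) atTop (𝓝 (J x')) :=
      (J.continuous.tendsto x').comp hx'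
    rw [hcoe_seq] at h1
    exact tendsto_nhds_unique h1 hιf'_lim
  have hqx' : ‖x'‖ ^ 2 - c * ‖J x'‖ ^ 2 = 0 := by
    have hcont : Continuous fun z : Completion V => ‖z‖ ^ 2 - c * ‖J z‖ ^ 2 := by fun_prop
    have h1 : Tendsto (fun n => ‖(f' n : Completion V)‖ ^ 2 - c * ‖J (f' n : Completion V)‖ ^ 2) atTop
        (𝓝 (‖x'‖ ^ 2 - c * ‖J x'‖ ^ 2)) := (hcont.tendsto x').comp hx'
    have hseq : (fun n => ‖(f' n : Completion V)‖ ^ 2 - c * ‖J (f' n : Completion V)‖ ^ 2) =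
        fun n => ‖f' n‖ ^ 2 - c * ‖ι (f' n)‖ ^ 2 :=
      funext fun n => by rw [Completion.norm_coe, hJcoe]
    rw [hseq] at h1
    exact tendsto_nhds_unique h1 hq'_lim
  exact ⟨x', hqx', hJx'⟩

end Contraction

/-! ### 3. The simplicity criterion -/

section Main

variable {X : Type*} [MeasurableSpace X] {μX : Measure X}
variable {V : Type*} [NormedAddCommGroup V] [InnerProductSpace ℝ V]

/-- ★ **Simplicity of the ground level of a semibounded form on `L²`, in core language** (Reed–Simon IV
Thm XIII.48 / Glimm–Jaffe Cor 3.3.4 in the variational form of Courant–Hilbert VI §6 and Lieb–Loss Thm 11.8).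
Data: a real inner product space `V` (the core, inner product `(𝔥+1)[·,·]`), not finite-dimensional;
`ι : V →L[ℝ] L²(X)`; `S : V → L²(X)` with `⟪f, g⟫_V = ⟪S f, ι g⟫ + ⟪ι f, ι g⟫`; Rellich (`ι` maps bounded sets to
totally bounded sets).  Hypotheses: (contraction) `∀ f ε, ε > 0 → ∃ f', ‖ι f' − |ι f|‖ ≤ ε ∧ ‖f'‖ ≤ ‖f‖ + ε`;
(positivity) every nonnegative nonzero weak solution `w ∈ closure ι(V)` of `⟪w, S g⟫ = c⟪w, ι g⟫ ∀ g`
satisfies `⟪w, v⟫ > 0` for all `v ≥ 0`, `v ≠ 0`.  Conclusion: the infimum of the min–max level set of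
dimension `1` is STRICTLY below that of dimension `2` (`μ₀ < μ₁`: the ground state is simple).
[cite: ReedSimonIV1978, Thm. XIII.48 (uniqueness of the ground state), with Thm. XIII.2 / XIII.64] -/
theorem sInf_coreLevelSet_zero_lt_one (hV : ¬ FiniteDimensional ℝ V) (ι : V →L[ℝ] Lp ℝ 2 μX)
    (S : V → Lp ℝ 2 μX) (hS : ∀ f g : V, ⟪f, g⟫_ℝ = ⟪S f, ι g⟫_ℝ + ⟪ι f, ι g⟫_ℝ)
    (htb : ∀ r : ℝ, TotallyBounded (ι '' Metric.closedBall (0 : V) r))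
    (habs : ∀ (f : V) (ε : ℝ), 0 < ε → ∃ f' : V, ‖ι f' - |ι f|‖ ≤ ε ∧ ‖f'‖ ≤ ‖f‖ + ε)
    (hpos : ∀ (c : ℝ) (w : Lp ℝ 2 μX), w ∈ closure (Set.range ι) →
      (∀ g : V, ⟪w, S g⟫_ℝ = c * ⟪w, ι g⟫_ℝ) → 0 ≤ w → w ≠ 0 →
      ∀ v : Lp ℝ 2 μX, 0 ≤ v → v ≠ 0 → 0 < ⟪w, v⟫_ℝ) :
    sInf {s : ℝ | ∃ W : Submodule ℝ V, Module.finrank ℝ W = 1 ∧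
        ∀ f ∈ W, ‖f‖ ^ 2 - ‖ι f‖ ^ 2 ≤ s * ‖ι f‖ ^ 2} <
      sInf {s : ℝ | ∃ W : Submodule ℝ V, Module.finrank ℝ W = 2 ∧
        ∀ f ∈ W, ‖f‖ ^ 2 - ‖ι f‖ ^ 2 ≤ s * ‖ι f‖ ^ 2} := by
  -- ### Step 0: the completed form domain `Q`, the embedding `J`, the form eigen-sequence
  have hS' : ∀ f g : V, ⟪f, g⟫_ℝ = ⟪ι f, S g⟫_ℝ + ⟪ι f, ι g⟫_ℝ := fun f g => by
    rw [← real_inner_comm f g, hS g f, real_inner_comm (ι f) (S g), real_inner_comm (ι f) (ι g)]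
  set L : V →L[ℝ] Completion V := Completion.toComplL with hL
  set J : Completion V →L[ℝ] Lp ℝ 2 μX := ι.extend L with hJ
  have hLcoe : ∀ f : V, L f = (f : Completion V) := fun f => by
    rw [hL]; exact congr_fun Completion.coe_toComplL f
  have hJcoe : ∀ f : V, J (f : Completion V) = ι f := fun f => extend_toComplL_coe ι f
  have hJi : Function.Injective J := extend_toComplL_injective_of_inner_eq ι S hS
  have hJc : IsCompactOperator J := isCompactOperator_extend_toComplL ι htb
  have hLi : Function.Injective (L : V →ₗ[ℝ] Completion V) := fun f g h => by
    have h' : (f : Completion V) = g := by rw [← hLcoe, ← hLcoe]; exact h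
    exact Completion.coe_injective V h'
  have hQ : ¬ FiniteDimensional ℝ (Completion V) := fun h =>
    hV (FiniteDimensional.of_injective (L : V →ₗ[ℝ] Completion V) hLi)
  obtain ⟨e, μ, hon, hmono, hμ1, -, hJn, horth, hweak, hglb⟩ :=
    exists_form_eigenseq hQ J hJc hJi
  have hJe0 : ∀ k, J (e k) ≠ 0 := fun k h0 => by
    have h := hJn k
    rw [h0, norm_zero, zero_pow two_ne_zero] at h
    have : 0 < (μ k + 1)⁻¹ := inv_pos.2 (by linarith [hμ1 k])
    linarith
  have hJcl : ∀ x : Completion V, J x ∈ closure (Set.range ι) := fun x =>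
    Completion.induction_on x (isClosed_closure.preimage J.continuous)
      fun f => subset_closure ⟨f, (hJcoe f).symm⟩
  have hcore : ∀ (g : V) (x : Completion V),
      ⟪x, (g : Completion V)⟫_ℝ = ⟪J x, S g⟫_ℝ + ⟪J x, ι g⟫_ℝ := fun g x =>
    Completion.induction_on x
      (isClosed_eq (continuous_id.inner continuous_const)
        ((J.continuous.inner continuous_const).add (J.continuous.inner continuous_const)))
      fun f => by rw [Completion.inner_coe, hJcoe, hS' f g]
  -- the core as a dense subspace of the completion; the level sets read on the core
  set D : Submodule ℝ (Completion V) := LinearMap.range (L : V →ₗ[ℝ] Completion V) with hD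
  have hDd : Dense (D : Set (Completion V)) := by
    have h1 : (D : Set (Completion V)) = Set.range ((↑) : V → Completion V) := by
      rw [hD, LinearMap.coe_range]
      ext x
      constructor
      · rintro ⟨f, rfl⟩; exact ⟨f, (hLcoe f).symm⟩
      · rintro ⟨f, rfl⟩; exact ⟨f, hLcoe f⟩
    rw [h1]
    exact Completion.denseRange_coe
  have hnormL : ∀ f : V, ‖(L : V →ₗ[ℝ] Completion V) f‖ = ‖f‖ := fun f => by
    rw [ContinuousLinearMap.coe_coe, hLcoe, Completion.norm_coe]
  have hJL : ∀ f : V, J ((L : V →ₗ[ℝ] Completion V) f) = ι f := fun f => by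
    rw [ContinuousLinearMap.coe_coe, hLcoe, hJcoe]
  have hSeq : ∀ k, {s : ℝ | ∃ W : Submodule ℝ V, Module.finrank ℝ W = k + 1 ∧
      ∀ f ∈ W, ‖f‖ ^ 2 - ‖ι f‖ ^ 2 ≤ s * ‖ι f‖ ^ 2} =
      {s : ℝ | ∃ W : Submodule ℝ (Completion V), Module.finrank ℝ W = k + 1 ∧ W ≤ D ∧
        ∀ x ∈ W, ‖x‖ ^ 2 - ‖J x‖ ^ 2 ≤ s * ‖J x‖ ^ 2} := by
    intro k
    ext s
    constructor
    · rintro ⟨W, hW, hWs⟩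
      refine ⟨W.map (L : V →ₗ[ℝ] Completion V), ?_, LinearMap.map_le_range, ?_⟩
      · rw [← (Submodule.equivMapOfInjective _ hLi W).finrank_eq, hW]
      · intro x hx
        obtain ⟨f, hf, rfl⟩ := Submodule.mem_map.1 hx
        rw [hnormL, hJL]
        exact hWs f hf
    · rintro ⟨W', hW', hW'D, hW's⟩
      refine ⟨W'.comap (L : V →ₗ[ℝ] Completion V), ?_, ?_⟩
      · have hmap : (W'.comap (L : V →ₗ[ℝ] Completion V)).map (L : V →ₗ[ℝ] Completion V) = W' := by
          rw [Submodule.map_comap_eq, ← hD]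
          exact inf_eq_right.2 hW'D
        rw [(Submodule.equivMapOfInjective _ hLi _).finrank_eq, hmap, hW']
      · intro f hf
        have h1 := hW's _ (Submodule.mem_comap.1 hf)
        rw [hnormL, hJL] at h1
        exact h1
  have hinf : ∀ k, sInf {s : ℝ | ∃ W : Submodule ℝ V, Module.finrank ℝ W = k + 1 ∧
      ∀ f ∈ W, ‖f‖ ^ 2 - ‖ι f‖ ^ 2 ≤ s * ‖ι f‖ ^ 2} = μ k := fun k => by
    rw [hSeq k]
    exact (hglb D hDd k).csInf_eq (hglb D hDd k).nonempty
  have hinf0 : sInf {s : ℝ | ∃ W : Submodule ℝ V, Module.finrank ℝ W = 1 ∧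
      ∀ f ∈ W, ‖f‖ ^ 2 - ‖ι f‖ ^ 2 ≤ s * ‖ι f‖ ^ 2} = μ 0 := by simpa using hinf 0
  have hinf1 : sInf {s : ℝ | ∃ W : Submodule ℝ V, Module.finrank ℝ W = 2 ∧
      ∀ f ∈ W, ‖f‖ ^ 2 - ‖ι f‖ ^ 2 ≤ s * ‖ι f‖ ^ 2} = μ 1 := by simpa using hinf 1
  rw [hinf0, hinf1]
  -- ### Step 1: `μ₀ ≤ μ₁`; suppose `μ₁ = μ₀`
  refine lt_of_le_of_ne (hmono zero_le_one) fun hμeq => ?_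
  -- ### Step 2: `q̃(x) = ‖x‖² − c‖Jx‖² ≥ 0` on `Q`, `c = μ₀ + 1`
  set c : ℝ := μ 0 + 1 with hc
  have hc0 : 0 < c := by rw [hc]; linarith [hμ1 0]
  have hq_nonneg : ∀ x : Completion V, 0 ≤ ‖x‖ ^ 2 - c * ‖J x‖ ^ 2 := by
    intro x
    by_cases hx : x = 0
    · rw [hx, map_zero, norm_zero]; simp
    have hJx : J x ≠ 0 := fun h => hx (hJi (by rw [h, map_zero]))
    have hJx2 : 0 < ‖J x‖ ^ 2 := by positivity
    have hdense : Dense ((⊤ : Submodule ℝ (Completion V)) : Set (Completion V)) := by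
      rw [Submodule.top_coe]; exact dense_univ
    set s : ℝ := (‖x‖ ^ 2 - ‖J x‖ ^ 2) / ‖J x‖ ^ 2 with hs
    have hsmem : s ∈ {s : ℝ | ∃ W : Submodule ℝ (Completion V), Module.finrank ℝ W = 0 + 1 ∧ W ≤ ⊤ ∧
        ∀ y ∈ W, ‖y‖ ^ 2 - ‖J y‖ ^ 2 ≤ s * ‖J y‖ ^ 2} := by
      refine ⟨Submodule.span ℝ {x}, by rw [zero_add, finrank_span_singleton hx], le_top, ?_⟩
      intro y hy
      obtain ⟨t, rfl⟩ := Submodule.mem_span_singleton.1 hy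
      rw [map_smul, norm_smul, norm_smul, mul_pow, mul_pow, Real.norm_eq_abs, sq_abs, hs]
      apply le_of_eq
      field_simp
    have h1 := (hglb ⊤ hdense 0).1 hsmem
    rw [hs, le_div_iff₀ hJx2] at h1
    rw [hc]
    linarith
  -- ### Step 3: first variation — null vectors of `q̃` satisfy the weak eigen-equation in `Q`
  have hvar : ∀ x y : Completion V, ‖x‖ ^ 2 - c * ‖J x‖ ^ 2 = 0 →
      ⟪x, y⟫_ℝ = c * ⟪J x, J y⟫_ℝ := by
    intro x y hx
    have key : ∀ t : ℝ, 0 ≤ 2 * t * (⟪x, y⟫_ℝ - c * ⟪J x, J y⟫_ℝ) + t ^ 2 * (‖y‖ ^ 2 - c * ‖J y‖ ^ 2) := by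
      intro t
      have h := hq_nonneg ((1 : ℝ) • x + t • y)
      rw [qf_expand J c 1 t x y, hx] at h
      linarith
    have := linear_coeff_eq_zero (hq_nonneg y) key
    linarith
  -- null vectors form a linear subspace
  have hlin : ∀ (a b : ℝ) (x y : Completion V), ‖x‖ ^ 2 - c * ‖J x‖ ^ 2 = 0 →
      ‖y‖ ^ 2 - c * ‖J y‖ ^ 2 = 0 → ‖a • x + b • y‖ ^ 2 - c * ‖J (a • x + b • y)‖ ^ 2 = 0 := by
    intro a b x y hx hy
    rw [qf_expand J c a b x y, hx, hy, hvar x y hx]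
    ring
  have hneg : ∀ x : Completion V, ‖x‖ ^ 2 - c * ‖J x‖ ^ 2 = 0 →
      ‖-x‖ ^ 2 - c * ‖J (-x)‖ ^ 2 = 0 := fun x hx => by
    rw [map_neg, norm_neg, norm_neg]; exact hx
  -- the weak eigen-equation in `H` for null vectors
  have hGweak : ∀ x : Completion V, ‖x‖ ^ 2 - c * ‖J x‖ ^ 2 = 0 →
      ∀ g : V, ⟪J x, S g⟫_ℝ = μ 0 * ⟪J x, ι g⟫_ℝ := by
    intro x hx g
    have h1 := hvar x (g : Completion V) hx
    rw [hcore g x, hJcoe] at h1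
    rw [hc] at h1
    linarith
  -- `e₀` and (as `μ₁ = μ₀`) `e₁` are null vectors
  have he_null : ∀ k, μ k = μ 0 → ‖e k‖ ^ 2 - c * ‖J (e k)‖ ^ 2 = 0 := by
    intro k hk
    rw [hon.1 k, hJn k, hk, hc, one_pow, mul_inv_cancel₀ (by linarith [hμ1 0] : μ 0 + 1 ≠ 0)]
    ring
  have he0 : ‖e 0‖ ^ 2 - c * ‖J (e 0)‖ ^ 2 = 0 := he_null 0 rfl
  have he1 : ‖e 1‖ ^ 2 - c * ‖J (e 1)‖ ^ 2 = 0 := he_null 1 hμeq.symm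
  -- ### Step 4: CONTRACTION — for a null vector `x` there is a null vector `x'` with `J x' = |J x|`
  have habsG : ∀ x : Completion V, ‖x‖ ^ 2 - c * ‖J x‖ ^ 2 = 0 →
      ∃ x' : Completion V, ‖x'‖ ^ 2 - c * ‖J x'‖ ^ 2 = 0 ∧ J x' = |J x| :=
    fun x hx => exists_null_abs ι J hJcoe hc0 hq_nonneg habs x hx
  -- ### Step 5: every null vector has a SIGN in `L²`
  have hsign : ∀ x : Completion V, ‖x‖ ^ 2 - c * ‖J x‖ ^ 2 = 0 → 0 ≤ J x ∨ J x ≤ 0 := by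
    intro x hx
    obtain ⟨x', hx', hJx'⟩ := habsG x hx
    -- `(Jx)⁺ = J((x'+x)/2)`, `(Jx)⁻ = J((x'-x)/2)`
    have e1 : (J x)⁺ + (J x)⁻ = |J x| := posPart_add_negPart (J x)
    have e2 : (J x)⁺ - (J x)⁻ = J x := posPart_sub_negPart (J x)
    have hp : J ((1 / 2 : ℝ) • x' + (1 / 2 : ℝ) • x) = (J x)⁺ := by
      rw [map_add, map_smul, map_smul, hJx', ← smul_add, ← e1]
      generalize (J x)⁺ = P at *
      generalize (J x)⁻ = N at *
      rw [← e2]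
      module
    have hn : J ((1 / 2 : ℝ) • x' + (-(1 / 2) : ℝ) • x) = (J x)⁻ := by
      rw [map_add, map_smul, map_smul, hJx', neg_smul, ← sub_eq_add_neg, ← smul_sub, ← e1]
      generalize (J x)⁺ = P at *
      generalize (J x)⁻ = N at *
      rw [← e2]
      module
    have hp0 := hlin (1 / 2) (1 / 2) x' x hx' hx
    have hn0 := hlin (1 / 2) (-(1 / 2)) x' x hx' hx
    by_contra hcon
    have hcon1 : ¬ 0 ≤ J x := fun h => hcon (Or.inl h)
    have hcon2 : ¬ J x ≤ 0 := fun h => hcon (Or.inr h)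
    have hpos_ne : (J x)⁺ ≠ 0 := fun h0 => hcon2 (by
      have := posPart_sub_negPart (J x)
      rw [h0, zero_sub] at this
      rw [← this]; exact neg_nonpos.2 (negPart_nonneg _))
    have hneg_ne : (J x)⁻ ≠ 0 := fun h0 => hcon1 (by
      have := posPart_sub_negPart (J x)
      rw [h0, sub_zero] at this
      rw [← this]; exact posPart_nonneg _)
    have hP := hpos (μ 0) (J x)⁺ (by rw [← hp]; exact hJcl _)
      (by rw [← hp]; exact hGweak _ hp0) (posPart_nonneg _) hpos_ne (J x)⁻ (negPart_nonneg _) hneg_ne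
    rw [inner_posPart_negPart_eq_zero] at hP
    exact lt_irrefl _ hP
  -- ### Step 6: two orthogonal null vectors with nonzero images are impossible
  have hkey : ∀ x y : Completion V, ‖x‖ ^ 2 - c * ‖J x‖ ^ 2 = 0 → ‖y‖ ^ 2 - c * ‖J y‖ ^ 2 = 0 →
      0 ≤ J x → J x ≠ 0 → 0 ≤ J y → J y ≠ 0 → ⟪J x, J y⟫_ℝ = 0 → False := by
    intro x y hx hy hx0 hxne hy0 hyne horth0
    have hP := hpos (μ 0) (J x) (hJcl x) (hGweak x hx) hx0 hxne (J y) hy0 hyne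
    rw [horth0] at hP
    exact lt_irrefl _ hP
  have h01 : ⟪J (e 0), J (e 1)⟫_ℝ = 0 := horth 0 1 zero_ne_one
  rcases hsign (e 0) he0 with h0 | h0 <;> rcases hsign (e 1) he1 with h1 | h1
  · exact hkey (e 0) (e 1) he0 he1 h0 (hJe0 0) h1 (hJe0 1) h01
  · refine hkey (e 0) (-e 1) he0 (hneg _ he1) h0 (hJe0 0) ?_ ?_ ?_
    · rw [map_neg]; exact neg_nonneg.2 h1
    · rw [map_neg]; exact neg_ne_zero.2 (hJe0 1)
    · rw [map_neg, inner_neg_right, h01, neg_zero]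
  · refine hkey (-e 0) (e 1) (hneg _ he0) he1 ?_ ?_ h1 (hJe0 1) ?_
    · rw [map_neg]; exact neg_nonneg.2 h0
    · rw [map_neg]; exact neg_ne_zero.2 (hJe0 0)
    · rw [map_neg, inner_neg_left, h01, neg_zero]
  · refine hkey (-e 0) (-e 1) (hneg _ he0) (hneg _ he1) ?_ ?_ ?_ ?_ ?_
    · rw [map_neg]; exact neg_nonneg.2 h0
    · rw [map_neg]; exact neg_ne_zero.2 (hJe0 0)
    · rw [map_neg]; exact neg_nonneg.2 h1
    · rw [map_neg]; exact neg_ne_zero.2 (hJe0 1)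
    · rw [map_neg, map_neg, inner_neg_left, inner_neg_right, h01, neg_zero, neg_zero]

end Main

end Literature.Analysis.UnboundedOperators

end
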